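import Literature.AlgebraicGeometry.Frobenioids.NumberFieldLocalizationCategoriesApplicationWitness
import Literature.AlgebraicGeometry.Frobenioids.NumberFieldLocalizationCategoriesFSMFF
import Literature.AlgebraicGeometry.Frobenioids.NumberFieldLocalizationReconstruction
import Literature.AlgebraicGeometry.Frobenioids.NumberFieldLocalizations
import HarnessLib

/-!
# Frobenioids II, Proposition 1.5 (vii): the printed form fails at `(V₄, 1)` (kernel witness)

Mochizuki, *The geometry of Frobenioids II: poly-Frobenioids*, Kyushu J. Math. **62** (2008)
401–460, §1, Proposition 1.5 (vii), author's text p. 14 [cite: MochizukiFrdII2008, Prop. 1.5 (vii) p.14].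

`NumberFieldLocalizationsMono.lean` proves Prop. 1.5 (vii) in the REPAIRED form
`NFLoc.dissectible_iff_fst`, under the extra hypothesis `hne` ("an object of `E` is non-initial iff its
projection to `P` is"), and records in its docstring that the printed form fails in the degenerate case
`D_v = 1`.  This PROOF-ONLY file kernel-checks that record with the model of the W-12 witness
(`NumberFieldLocalizationCategoriesApplicationWitness.lean`): `(G, D) = (ℤ/2 × ℤ/2, 1)` (discrete, hence
profinite; arithmetically `(Gal(ℚ(√2,√3)/ℚ), D_{23})`), `P := P₀`, `F := 𝟭`, `π := E₀ → P₀`.  Then every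
hypothesis of `NFLoc.dissectible_iff_fst` other than `hne` holds (faithful, essentially surjective,
reconstruction property — seats d9/d4), yet the object of `E` over `G/G` is weakly dissectible while its
projection is initial.  Recorded neutrally (erratum-class; same family as FLAG #12); no side is taken on
the intended reading of the printed sentence.
-/

namespace Literature.AlgebraicGeometry.Frobenioids

namespace NFLocCat

open CategoryTheory CategoryTheory.Limits

open scoped FintypeCatDiscrete

/-! ### Tightness of the non-degeneracy hypothesis in the repaired Prop. 1.5 (vii) -/

/-- The same model exhibits the degenerate case of [FrdII] Prop. 1.5 (vii) recorded in
`NFLoc.dissectible_iff_fst` (whose extra hypothesis `hne` — "non-initial in `E` iff non-initial in `P`" —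
is therefore NEEDED): for `(G, D) = (ℤ/2 × ℤ/2, 1)`, `P := P₀`, `F := 𝟭`, `π := E₀ → P₀`, the object of
`E = P ×_{P₀} E₀` over `Q = G/G` is weakly dissectible while its projection to `P` is initial (hence not
weakly dissectible). [cite: MochizukiFrdII2008, Prop. 1.5 (vii) p.14] -/
theorem exists_isWeaklyDissectible_fst_initial :
    ∃ X : CFP (𝟭 (@PCat (Multiplicative (ZMod 2) × Multiplicative (ZMod 2)) _ ⊥ (⊥ : Subgroup (Multiplicative (ZMod 2) × Multiplicative (ZMod 2)))))
        (@toP₀ (Multiplicative (ZMod 2) × Multiplicative (ZMod 2)) _ ⊥ (⊥ : Subgroup (Multiplicative (ZMod 2) × Multiplicative (ZMod 2)))),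
      IsWeaklyDissectible X ∧ Nonempty (IsInitial X.fst) := by
  letI : TopologicalSpace (Multiplicative (ZMod 2) × Multiplicative (ZMod 2)) := ⊥
  haveI : DiscreteTopology (Multiplicative (ZMod 2) × Multiplicative (ZMod 2)) := ⟨rfl⟩
  haveI : IsTopologicalGroup (Multiplicative (ZMod 2) × Multiplicative (ZMod 2)) :=
    { continuous_mul := continuous_of_discreteTopology
      continuous_inv := continuous_of_discreteTopology }
  let D : Subgroup (Multiplicative (ZMod 2) × Multiplicative (ZMod 2)) := ⊥
  -- the two coordinate subgroups `A`, `B` and their basic properties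
  let A : Subgroup (Multiplicative (ZMod 2) × Multiplicative (ZMod 2)) := (MonoidHom.snd (Multiplicative (ZMod 2)) (Multiplicative (ZMod 2))).ker
  let B : Subgroup (Multiplicative (ZMod 2) × Multiplicative (ZMod 2)) := (MonoidHom.fst (Multiplicative (ZMod 2)) (Multiplicative (ZMod 2))).ker
  have hAB : A ⊓ B = ⊥ := by
    refine le_antisymm (fun g hg => ?_) bot_le
    rw [Subgroup.mem_bot]
    exact Prod.ext hg.2 hg.1
  let a : (Multiplicative (ZMod 2) × Multiplicative (ZMod 2)) := (Multiplicative.ofAdd 1, 1)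
  have haA : a ∈ A := rfl
  have ha1 : a ≠ 1 := by decide
  -- coset objects `G/A`, `G/B`, `G/1` and the one-point objects
  obtain ⟨QA, qA, hstA, htrA, hmapA⟩ := BCat.exists_coset_obj (G := (Multiplicative (ZMod 2) × Multiplicative (ZMod 2))) A (isOpen_discrete _)
  obtain ⟨QB, qB, hstB, htrB, hmapB⟩ := BCat.exists_coset_obj (G := (Multiplicative (ZMod 2) × Multiplicative (ZMod 2))) B (isOpen_discrete _)
  obtain ⟨QF, qF, hstF, htrF, -⟩ := BCat.exists_coset_obj (G := (Multiplicative (ZMod 2) × Multiplicative (ZMod 2))) (⊥ : Subgroup (Multiplicative (ZMod 2) × Multiplicative (ZMod 2))) (isOpen_discrete _)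
  obtain ⟨QT, qT, hQT, hqT⟩ := exists_point_obj (Multiplicative (ZMod 2) × Multiplicative (ZMod 2))
  obtain ⟨PT, pT, hPT, hpT⟩ := exists_point_obj (↥D)
  -- stabilisers in `G/A`, `G/B` are `A`, `B` (abelian group), in `G/1` trivial
  have stab_le : ∀ (U : Subgroup (Multiplicative (ZMod 2) × Multiplicative (ZMod 2))) (Q : BCat (Multiplicative (ZMod 2) × Multiplicative (ZMod 2))) (q₀ : Q.obj.V), MulAction.stabilizer (Multiplicative (ZMod 2) × Multiplicative (ZMod 2)) q₀ = U →
      (∀ q : Q.obj.V, ∃ g : (Multiplicative (ZMod 2) × Multiplicative (ZMod 2)), g • q₀ = q) → ∀ q : Q.obj.V, MulAction.stabilizer (Multiplicative (ZMod 2) × Multiplicative (ZMod 2)) q ≤ U := by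
    intro U Q q₀ hst htr q k hk
    obtain ⟨g, rfl⟩ := htr q
    rw [MulAction.mem_stabilizer_iff, ← mul_smul, mul_comm, mul_smul] at hk
    have hk' : k • q₀ = q₀ := smul_left_cancel g hk
    rw [← hst]
    exact hk'
  -- the objects `T_U = (pt, Q_U, ι_U)` of `E₀` and `X_U = (pt, T_U, refl)` of `E`
  let mkι : ∀ (Q : BCat (Multiplicative (ZMod 2) × Multiplicative (ZMod 2))) (q : Q.obj.V), (PT ⟶ (res (Multiplicative (ZMod 2) × Multiplicative (ZMod 2)) D).obj Q) := fun Q q =>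
    ObjectProperty.homMk
      { hom := FintypeCat.homMk fun _ => (q : ((res (Multiplicative (ZMod 2) × Multiplicative (ZMod 2)) D).obj Q).obj.V)
        comm := fun d => FintypeCat.hom_ext _ _ fun _ => by
          have hd : d = 1 := Subtype.ext ((Subgroup.mem_bot).mp d.2)
          subst hd
          change q = ((1 : ↥D) : (Multiplicative (ZMod 2) × Multiplicative (ZMod 2))) • q
          rw [OneMemClass.coe_one, one_smul] }
  have hmono : ∀ (Q : BCat (Multiplicative (ZMod 2) × Multiplicative (ZMod 2))) (q : Q.obj.V), Mono (mkι Q q) := fun Q q =>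
    BCat.mono_of_injective _ fun x y _ => (hpT x).trans (hpT y).symm
  let mkT : ∀ (Q : BCat (Multiplicative (ZMod 2) × Multiplicative (ZMod 2))) (q : Q.obj.V), IsConnectedObj Q → ECat (Multiplicative (ZMod 2) × Multiplicative (ZMod 2)) D := fun Q q hQ =>
    ⟨⟨⟨PT, hPT⟩, ⟨Q, hQ⟩, mkι Q q⟩, hmono Q q⟩
  let E := CFP (𝟭 (PCat (Multiplicative (ZMod 2) × Multiplicative (ZMod 2)) D)) (toP₀ (Multiplicative (ZMod 2) × Multiplicative (ZMod 2)) D)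
  let mkX : ∀ (Q : BCat (Multiplicative (ZMod 2) × Multiplicative (ZMod 2))) (q : Q.obj.V), IsConnectedObj Q → E := fun Q q hQ =>
    ⟨⟨PT, hPT⟩, mkT Q q hQ, Iso.refl _⟩
  have hQA : IsConnectedObj QA := BCat.isConnectedObj_of_transitive QA qA htrA
  have hQB : IsConnectedObj QB := BCat.isConnectedObj_of_transitive QB qB htrB
  have hQF : IsConnectedObj QF := BCat.isConnectedObj_of_transitive QF qF htrF
  let XA : E := mkX QA qA hQA
  let XB : E := mkX QB qB hQB
  let XF : E := mkX QF qF hQF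
  let XT : E := mkX QT qT hQT
  -- the arrows `X_U → X_⊤`
  let toT : ∀ (Q : BCat (Multiplicative (ZMod 2) × Multiplicative (ZMod 2))) (q : Q.obj.V) (hQ : IsConnectedObj Q), (mkX Q q hQ ⟶ XT) := fun Q q hQ =>
    { fst := 𝟙 _
      snd := ObjectProperty.homMk
        { left := 𝟙 _
          right := ObjectProperty.homMk (ObjectProperty.homMk
            { hom := FintypeCat.homMk fun _ => qT
              comm := fun _ => FintypeCat.hom_ext _ _ fun _ => (hqT _).symm })
          w := BCat.hom_ext_apply fun _ => (hqT _).trans (hqT _).symm }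
      w := ptHom_unique _ _ }
  -- (1) `X_A`, `X_B` are non-initial: a map `X_A → X_1` would force `A ⊆ Stab = 1`
  have nonempty_of : ∀ (Q : BCat (Multiplicative (ZMod 2) × Multiplicative (ZMod 2))) (q : Q.obj.V) (hQ : IsConnectedObj Q) (g : (Multiplicative (ZMod 2) × Multiplicative (ZMod 2))), g ≠ 1 →
      g ∈ MulAction.stabilizer (Multiplicative (ZMod 2) × Multiplicative (ZMod 2)) q → IsNonemptyObj (mkX Q q hQ) := by
    intro Q q hQ g hg1 hgq
    refine ⟨fun hI => hg1 ?_⟩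
    let k := hI.to XF
    have h1 := stabilizer_le_of_hom k.snd.hom.right.hom q hgq
    have h2 := stab_le ⊥ QF qF hstF htrF _ h1
    rwa [Subgroup.mem_bot] at h2
  have hXA : IsNonemptyObj XA := nonempty_of QA qA hQA a ha1 (by rw [hstA]; exact haA)
  let b : (Multiplicative (ZMod 2) × Multiplicative (ZMod 2)) := (1, Multiplicative.ofAdd 1)
  have hbB : b ∈ B := rfl
  have hb1 : b ≠ 1 := by decide
  have hXB : IsNonemptyObj XB := nonempty_of QB qB hQB b hb1 (by rw [hstB]; exact hbB)
  -- (2) an object of `E` mapping to both `X_A` and `X_B` has free `Q`-part, hence is initial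
  have key : ∀ (Y₀ : E), (Y₀ ⟶ XA) → (Y₀ ⟶ XB) → ¬ IsNonemptyObj Y₀ := by
    intro Y₀ fA fB hY₀
    apply hY₀.false
    let p₀ := (nonempty_left D Y₀.snd).some
    let q₀ : Y₀.snd.obj.right.obj.obj.V := Y₀.snd.obj.hom.hom.hom p₀
    have hQc : IsConnectedObj Y₀.snd.obj.right.obj := Y₀.snd.obj.right.property
    have htr₀ : ∀ z : Y₀.snd.obj.right.obj.obj.V, ∃ g : (Multiplicative (ZMod 2) × Multiplicative (ZMod 2)), g • q₀ = z := fun z =>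
      BCat.exists_smul_eq_of_isConnectedObj _ hQc q₀ z
    have hfree : MulAction.stabilizer (Multiplicative (ZMod 2) × Multiplicative (ZMod 2)) q₀ = ⊥ := by
      refine le_antisymm ?_ bot_le
      rw [← hAB]
      exact le_inf
        ((stabilizer_le_of_hom fA.snd.hom.right.hom q₀).trans (stab_le A QA qA hstA htrA _))
        ((stabilizer_le_of_hom fB.snd.hom.right.hom q₀).trans (stab_le B QB qB hstB htrB _))
    refine IsInitial.ofUniqueHom (fun Y => ?_) (fun Y m => ?_)
    · -- existence of a morphism `Y₀ → Y`
      let pY := (nonempty_left D Y.snd).some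
      let y : Y.snd.obj.right.obj.obj.V := Y.snd.obj.hom.hom.hom pY
      let hr := exists_hom_of_free Y₀.snd.obj.right.obj Y.snd.obj.right.obj q₀ htr₀ hfree y
      refine
        { fst := (nonempty_ptHom _ _).some
          snd := ObjectProperty.homMk
            { left := (nonempty_ptHom _ _).some
              right := ObjectProperty.homMk hr.choose
              w := BCat.hom_ext_apply fun p => ?_ }
          w := ptHom_unique _ _ }
      have hp : p = p₀ := pt_eq Y₀.snd.obj.left p p₀
      rw [hp]
      change Y.snd.obj.hom.hom.hom
          ((nonempty_ptHom Y₀.snd.obj.left Y.snd.obj.left).some.hom.hom.hom p₀) = hr.choose.hom.hom q₀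
      rw [hr.choose_spec]
      exact congrArg _ (pt_eq Y.snd.obj.left _ _)
    · exact CFP.hom_ext (ptHom_unique _ _) (hom_eq_of_left_eq D (ptHom_unique _ _))
  -- (3) `X_⊤` is weakly dissected by `X_A`, `X_B`
  let Xs : Fin 2 → E := fun i => match i with | 0 => XA | 1 => XB
  let φs : ∀ i, Xs i ⟶ XT := fun i => match i with | 0 => toT QA qA hQA | 1 => toT QB qB hQB
  refine ⟨XT, ⟨Xs, φs, ?_, ?_⟩, isInitial_pt _⟩
  · intro i
    fin_cases i
    · exact hXA
    · exact hXB
  · intro i j hij Y₀ hY₀ ψi ψj _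
    fin_cases i <;> fin_cases j
    · exact (hij rfl).elim
    · exact key Y₀ ψi ψj hY₀
    · exact key Y₀ ψj ψi hY₀
    · exact (hij rfl).elim

/-- Hence, at `(ℤ/2 × ℤ/2, 1)` with `P := P₀`, `F := 𝟭`, the PRINTED form of Prop. 1.5 (vii) ("`A_P` is
weakly dissectible iff `A_E` is") fails, although `E₀ → P₀` is faithful, essentially surjective and
satisfies the reconstruction property of Prop. 1.5 (i) (d9/d4: `toP₀Faithful_holds`,
`toP₀ArrowwiseEssSurj_holds`, `homReconstruction_toP₀`) — i.e. every hypothesis of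
`NFLoc.dissectible_iff_fst` other than `hne` holds. Recorded neutrally (erratum-class, same family as
FLAG #12). [cite: MochizukiFrdII2008, Prop. 1.5 (vii) p.14] -/
theorem not_forall_isWeaklyDissectible_iff_fst :
    (@toP₀ (Multiplicative (ZMod 2) × Multiplicative (ZMod 2)) _ ⊥ (⊥ : Subgroup (Multiplicative (ZMod 2) × Multiplicative (ZMod 2)))).Faithful ∧
    (@toP₀ (Multiplicative (ZMod 2) × Multiplicative (ZMod 2)) _ ⊥ (⊥ : Subgroup (Multiplicative (ZMod 2) × Multiplicative (ZMod 2)))).EssSurj ∧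
    NFLoc.HomReconstruction (@toP₀ (Multiplicative (ZMod 2) × Multiplicative (ZMod 2)) _ ⊥ (⊥ : Subgroup (Multiplicative (ZMod 2) × Multiplicative (ZMod 2)))) ∧
    ¬ ∀ X : CFP (𝟭 (@PCat (Multiplicative (ZMod 2) × Multiplicative (ZMod 2)) _ ⊥ (⊥ : Subgroup (Multiplicative (ZMod 2) × Multiplicative (ZMod 2)))))
        (@toP₀ (Multiplicative (ZMod 2) × Multiplicative (ZMod 2)) _ ⊥ (⊥ : Subgroup (Multiplicative (ZMod 2) × Multiplicative (ZMod 2)))),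
      (IsWeaklyDissectible X.fst ↔ IsWeaklyDissectible X) := by
  letI : TopologicalSpace (Multiplicative (ZMod 2) × Multiplicative (ZMod 2)) := ⊥
  haveI : DiscreteTopology (Multiplicative (ZMod 2) × Multiplicative (ZMod 2)) := ⟨rfl⟩
  haveI : IsTopologicalGroup (Multiplicative (ZMod 2) × Multiplicative (ZMod 2)) :=
    { continuous_mul := continuous_of_discreteTopology
      continuous_inv := continuous_of_discreteTopology }
  refine ⟨toP₀Faithful_holds (G := (Multiplicative (ZMod 2) × Multiplicative (ZMod 2))) (⊥ : Subgroup (Multiplicative (ZMod 2) × Multiplicative (ZMod 2))),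
    essSurj_of_isArrowwiseEssSurj _ (toP₀ArrowwiseEssSurj_holds (G := (Multiplicative (ZMod 2) × Multiplicative (ZMod 2))) (⊥ : Subgroup (Multiplicative (ZMod 2) × Multiplicative (ZMod 2)))),
    homReconstruction_toP₀ (G := (Multiplicative (ZMod 2) × Multiplicative (ZMod 2))) (D := (⊥ : Subgroup (Multiplicative (ZMod 2) × Multiplicative (ZMod 2)))), fun hall => ?_⟩
  obtain ⟨X, hX, ⟨hI⟩⟩ := exists_isWeaklyDissectible_fst_initial
  obtain ⟨Xs, _, hne, _⟩ := (hall X).mpr hX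
  exact (hne 0).false (isInitial_pt (Xs 0)).some


end NFLocCat

end Literature.AlgebraicGeometry.Frobenioids
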